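import Summits.BirchSwinnertonDyer.BirchSwinnertonDyer.Theses.ByReductionTypeAtTwo
import Summits.BirchSwinnertonDyer.BirchSwinnertonDyer.Theorems.ByReductionTypeAtTwoRankOneAtTwoBigImageOddLocalOneDoorGlue
import Summits.BirchSwinnertonDyer.BirchSwinnertonDyer.Theorems.RamifiedHeegnerPairRamifiedPairUpperBoundOfUpperHalfOverK
import Literature.NumberTheory.EllipticCurves.AnomalousOfRationalTorsionProofs
import Literature.NumberTheory.EllipticCurves.SelmerTrivialCorankProofs
import Literature.NumberTheory.EllipticCurves.TwistFamilySelmerGroupCardInvarianceProofs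
import Literature.NumberTheory.EllipticCurves.AnalyticRankOrderProofs
import Literature.NumberTheory.EllipticCurves.RegulatorProofs
import HarnessLib

/-!
# Route ByReductionTypeAtTwo, crux `RankOneAtTwoBigImageOddLocal` (stmt-BirchSwinnertonDyer-23715), line `one_door_law`:
# the VALUE stub reshaped — `DoorTwistValueAtTwo` from the `2`-converse, the route's rank-`0` cruxes and the Tamagawa receptacle

Lead prover seat `bsd-line-fkl-p1` g6 (2026-08-28), skeleton v7.3.  The registered value stub of the line,
`DoorTwistValueAtTwo` («for a `Sel₂`-trivial door twist `E^{(d)}`: `q_d = L(E^{(d)},1)/Ω(E^{(d)}_min) ≠ 0` and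
`ord₂ q_d = ord₂ ∏ c_ℓ(E) + t + 2s`»), is here DERIVED in the kernel from three named inputs:

* (V1) `DoorTwistConverseAtTwo` — the rank-`0` `2`-converse `Sel₂(E^{(d)}) = 0 ⇒ L(E^{(d)},1) ≠ 0` (OPEN, `@[conjecture]`,
  `…OneDoorLawDefs.lean` APPEND p613572);
* (V2) `DoorTwistBSDTwoAtTwo` — rank-`0` `BSD₂` of the `Sel₂`-TRIVIAL door twist (receptacle, `…OneDoorLawDefs.lean` APPEND
  p614035); it is DERIVED here (`doorTwistBSDTwoAtTwo_of_rankZero_cruxes`) from the route's OWN rank-`0` cruxes at `2`, BY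
  NAME: `GoodOrdinaryRankZeroAtTwo ∧ MultiplicativeRankZeroAtTwo ∧ SupersingularRankZeroAtTwo ∧ AdditiveRankZeroAtTwo` (items
  19095–19098 of `Theses/ByReductionTypeAtTwo.lean`; case split on the reduction type of the non-CM twist model at `2`), and is
  much weaker than them (trivial `2`-Selmer only; printed for the quadratic-twist families of Zhai 2016 / Cai–Li–Zhai 2019);
* (V3) `DoorTwistTamagawaAtTwo` — `ord₂ ∏ c_ℓ(Wd) = ord₂ ∏ c_ℓ(W) + t + 2s` (receptacle; Tate `I₀*` at the door primes);

plus modularity (`hasEntireLFunction_rat`, a conjunct of `S_pub`).  The kernel content proved here: `Sel₂(Wd) = 0` forces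
`rank Wd(ℚ) = 0`, `Wd(ℚ)[2] = 0` (so `#Wd(ℚ)_tors` is odd) and `Ш(Wd)[2^∞] = 0` (tree `SelmerTrivialCorankProofs` +
`natCard_selmerGroup_smul`), the twist model is non-CM, its reduction type at `2` is one of the route's four, and Miller's
`BSD(Wd, 2)` in rank `0` unpacks (`leadingLCoeff = L(Wd,1)`, `Reg = 1`) to `ord₂ (L(Wd,1)/Ω(Wd)) = ord₂ ∏ c_ℓ(Wd) − 2 ord₂ #T =
ord₂ ∏ c_ℓ(Wd)`.  BSD is not proved by any of this; V1 is open, V2 is an open receptacle (implied by open cruxes of the route), V3 is an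
unproved receptacle.
-/

set_option autoImplicit false

noncomputable section

open scoped Classical

set_option linter.dupNamespace false

namespace Summit.BirchSwinnertonDyer.BirchSwinnertonDyer.Theorems.RankOneAtTwoOneDoor

open WeierstrassCurve Literature.NumberTheory.EllipticCurves Literature.NumberTheory.EllipticCurves.ModularForms
  Literature.NumberTheory.EllipticCurves.KrizLi2019
  Literature.NumberTheory.EllipticCurves.Rank1Residual
  Summit.BirchSwinnertonDyer.Rank1Residual.F1Sign2
  Summit.BirchSwinnertonDyer.Rank1Residual.F1Sign2.TranspositionDoor
  Summit.BirchSwinnertonDyer.BirchSwinnertonDyer.Theses.ByReductionTypeAtTwo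

/-! ### §1 `Sel₂`-triviality of the door twist, read on its minimal model -/

/-- `E(ℚ)[2] = 0` forces `#E(ℚ)_tors` odd (Cauchy in the finite group `E(ℚ)_tors`, tree
`exists_addOrderOf_eq_of_dvd_torsionOrder`). [folklore] -/
theorem odd_torsionOrder_of_two_smul_eq_zero (V : WeierstrassCurve ℚ) [V.IsElliptic]
    (h2 : ∀ T : V.toAffine.Point, 2 • T = 0 → T = 0) : Odd V.torsionOrder := by
  rw [← Nat.not_even_iff_odd, even_iff_two_dvd]
  intro hdvd
  haveI : Fact (Nat.Prime 2) := ⟨Nat.prime_two⟩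
  obtain ⟨T, hT⟩ := exists_addOrderOf_eq_of_dvd_torsionOrder V 2 hdvd
  have h2T : 2 • T = 0 := by
    have h := addOrderOf_nsmul_eq_zero T
    rwa [hT] at h
  have hT0 : T = 0 := h2 T h2T
  rw [hT0, addOrderOf_zero] at hT
  exact absurd hT (by norm_num)

/-- **`Sel₂(W^{(d)}) = 0`, read on a minimal model `Wd = Cd • W^{(d)}`**: `rank Wd(ℚ) = 0`, `#Wd(ℚ)_tors` odd,
`Ш(Wd)[2^∞] = 0` (hence finite of order `1`).  Descent count X.4.2 (`SelmerTrivialCorankProofs`) + invariance of `#Sel₂`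
under `ℚ`-isomorphism (`natCard_selmerGroup_smul`). [cite: SilvermanAEC2009, Thm. X.4.2] -/
theorem twist_arith_of_selmerTrivial (W : WeierstrassCurve ℚ) [W.IsElliptic] {d : ℤ} (hd : (d : ℚ) ≠ 0)
    (hSel : twistSelmerTwoCard W d = 1)
    (Wd : WeierstrassCurve ℚ) [Wd.IsElliptic] (Cd : VariableChange ℚ) (hWd : Cd • W.quadraticTwist (d : ℚ) = Wd) :
    Wd.mordellWeilRank = 0 ∧ Odd Wd.torsionOrder ∧ AddCommGroup.primaryComponent Wd.sha 2 = ⊥ := by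
  haveI : Fact (Nat.Prime 2) := ⟨Nat.prime_two⟩
  haveI : (W.quadraticTwist (d : ℚ)).IsElliptic := W.isElliptic_quadraticTwist hd
  have hcard : Nat.card (Wd.selmerGroup ((2 : ℕ) : ℤ)) = 1 := by
    have hsm := natCard_selmerGroup_smul (W.quadraticTwist (d : ℚ)) Cd (two_ne_zero (α := ℕ))
    rw [hWd] at hsm
    rw [hsm]
    have : ((2 : ℕ) : ℤ) = 2 := rfl
    rw [this]
    exact hSel
  obtain ⟨hrk, htors, -⟩ :=
    rank_eq_zero_and_torsionBy_eq_bot_and_sha_inf_torsionBy_eq_bot_of_natCard_selmerGroup_eq_one Wd 2 hcard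
  have h2 : ∀ T : Wd.toAffine.Point, 2 • T = 0 → T = 0 := by
    intro T hT
    have hmem : T ∈ AddSubgroup.torsionBy Wd.toAffine.Point ((2 : ℕ) : ℤ) :=
      AddSubgroup.torsionBy.nsmul_iff.mpr hT
    -- the tree lemma carries the classical `DecidableEq ℚ` instance of the group law, this file the computable one:
    -- the two `torsionBy` subgroups agree by `Subsingleton.elim` on the instance (`convert`)
    have hbot : AddSubgroup.torsionBy Wd.toAffine.Point ((2 : ℕ) : ℤ) = ⊥ := by
      convert htors using 3
      all_goals
        first
        | (congr 1; exact Subsingleton.elim _ _)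
        | (congr 2; exact Subsingleton.elim _ _)
    rw [hbot] at hmem
    exact hmem
  exact ⟨hrk, odd_torsionOrder_of_two_smul_eq_zero Wd h2,
    primaryComponent_sha_eq_bot_of_natCard_selmerGroup_eq_one Wd 2 hcard⟩

/-! ### §2 Rank-`0` `BSD₂` of the twist from the route's four cruxes -/

/-- The route's four rank-`0` cruxes at `2` cover every non-CM curve of analytic rank `0` (case split on the reduction type
at `2`, as in the route's own assembly `byReductionTypeAtTwo_assembly_proof`). -/
theorem bsdp_two_of_rankZero_cruxes
    (hR0 : GoodOrdinaryRankZeroAtTwo ∧ MultiplicativeRankZeroAtTwo ∧ SupersingularRankZeroAtTwo ∧ AdditiveRankZeroAtTwo)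
    (V : WeierstrassCurve ℚ) [V.IsElliptic] [V.IsGloballyMinimal] (hCM : ¬ V.HasCM) (hr : V.analyticRank = 0) :
    BSDp V 2 := by
  obtain ⟨hOrd, hMult, hSS, hAdd⟩ := hR0
  by_cases hg : V.HasGoodReductionAtPrime 2
  · by_cases ha : (2 : ℤ) ∣ V.frobeniusTrace 2
    · exact hSS V hCM hr ⟨hg, by exact_mod_cast ha⟩
    · exact hOrd V hCM hr ⟨hg, by exact_mod_cast ha⟩
  · by_cases hm : V.HasMultiplicativeReductionAtPrime 2
    · exact hMult V hCM hr hm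
    · exact hAdd V hCM hr ⟨hg, hm⟩

/-- **(V2) from the route's rank-`0` cruxes, BY NAME**: the `Sel₂`-trivial door twist of a non-CM curve is non-CM
(`j` is a twist invariant), so the four cruxes give `BSD(Wd, 2)` in analytic rank `0`. -/
theorem doorTwistBSDTwoAtTwo_of_rankZero_cruxes
    (hR0 : GoodOrdinaryRankZeroAtTwo ∧ MultiplicativeRankZeroAtTwo ∧ SupersingularRankZeroAtTwo ∧ AdditiveRankZeroAtTwo) :
    DoorTwistBSDTwoAtTwo := by
  intro W _ _ hCM _hT2 d hadm _hSel Wd _ _ Cd hWd hrd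
  have hd0 : (d : ℚ) ≠ 0 := by
    have : d < 0 := hadm.1
    exact_mod_cast this.ne
  haveI : (W.quadraticTwist (d : ℚ)).IsElliptic := W.isElliptic_quadraticTwist hd0
  exact bsdp_two_of_rankZero_cruxes hR0 Wd (RamifiedPairUpperBound.not_hasCM_of_smul_quadraticTwist_eq hd0 hWd hCM) hrd

/-! ### §3 The value stub from (V1), (V2), (V3) -/

/-- **`DoorTwistValueAtTwo` DERIVED** (skeleton v7.3: the value stub is discharged modulo the `2`-converse (V1), the rank-`0`
`BSD₂` of the `Sel₂`-trivial twist (V2) and the Tamagawa receptacle (V3)).  For a `Sel₂`-trivial door twist with minimal model `Wd`: `L(Wd,1) ≠ 0`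
(V1 + `entireLFunction_smul`), so `r_an(Wd) = 0` (modularity); `BSD(Wd,2)` (V2); `rank 0`, odd torsion,
`Ш[2^∞] = 0` (§1); hence with `q_d := q · ∏c_ℓ(Wd) / #T²` (`q = #Ш_an(Wd)`): `L(Wd,1)/Ω(Wd) = q_d ≠ 0` and
`ord₂ q_d = 0 + ord₂ ∏ c_ℓ(Wd) − 0 = ord₂ ∏ c_ℓ(W) + t + 2s` (V3). -/
theorem doorTwistValueAtTwo_of (hmod : hasEntireLFunction_rat) (hConv : DoorTwistConverseAtTwo)
    (hBSD : DoorTwistBSDTwoAtTwo) (hTam : DoorTwistTamagawaAtTwo) : DoorTwistValueAtTwo := by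
  intro W _ _ hCM hT2 d hadm hSel Wd _ _ Cd hWd
  haveI : Fact (Nat.Prime 2) := ⟨Nat.prime_two⟩
  have hd0 : (d : ℚ) ≠ 0 := by
    have : d < 0 := hadm.1
    exact_mod_cast this.ne
  haveI hEt : (W.quadraticTwist (d : ℚ)).IsElliptic := W.isElliptic_quadraticTwist hd0
  -- (V1): `L(Wd, 1) ≠ 0`, hence analytic rank `0`
  have hLt : (W.quadraticTwist (d : ℚ)).entireLFunction 1 ≠ 0 := hConv W hCM hT2 d hadm hSel
  have hLeq : Wd.entireLFunction = (W.quadraticTwist (d : ℚ)).entireLFunction := by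
    rw [← hWd, entireLFunction_smul]
  have hLd : Wd.entireLFunction 1 ≠ 0 := by rw [hLeq]; exact hLt
  have hrd : Wd.analyticRank = 0 := (Wd.analyticRank_eq_zero_iff_holds (hmod Wd)).2 hLd
  -- (V2): `BSD(Wd, 2)`
  obtain ⟨-, hfin, q, hq, hv⟩ := hBSD W hCM hT2 d hadm hSel Wd Cd hWd hrd
  -- §1: rank `0`, odd torsion, `Ш[2^∞] = 0`
  obtain ⟨hrk, hTodd, hSha⟩ := twist_arith_of_selmerTrivial W hd0 hSel Wd Cd hWd
  have hcard1 : Nat.card (AddCommGroup.primaryComponent Wd.sha 2) = 1 := by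
    rw [hSha]; exact Nat.card_unique
  have hv0 : padicValRat 2 q = 0 := by rw [hv, hcard1]; simp
  clear hv
  -- (V3): Tamagawa numbers
  have hvTam : padicValNat 2 Wd.tamagawaProduct =
      padicValNat 2 W.tamagawaProduct + transpCount W d + 2 * identCount W d := hTam W d hadm Wd Cd hWd
  -- Miller's `#Ш_an(Wd)` in rank `0`
  have hlead : Wd.leadingLCoeff = Wd.entireLFunction 1 :=
    WeierstrassCurve.leadingLCoeff_eq_of_analyticRank_eq_zero Wd hrd
  have hreg : Wd.regulator = 1 := Wd.regulator_eq_one_of_rank_zero hrk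
  have hΩpos : 0 < Wd.realPeriodRat := Wd.realPeriodRat_pos_holds
  have hΩC : (Wd.realPeriodRat : ℂ) ≠ 0 := by exact_mod_cast hΩpos.ne'
  have hT0 : 0 < Wd.torsionOrder := Wd.torsionOrder_pos_holds
  have hTC : (Wd.torsionOrder : ℂ) ≠ 0 := by exact_mod_cast hT0.ne'
  have hc0 : 0 < Wd.tamagawaProduct := Wd.tamagawaProduct_pos_holds
  have hcC : (Wd.tamagawaProduct : ℂ) ≠ 0 := by exact_mod_cast hc0.ne'
  -- `L(Wd,1)/Ω = q · Tam / T²`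
  set qd : ℚ := q * Wd.tamagawaProduct / (Wd.torsionOrder : ℚ) ^ 2 with hqd_def
  have hsha := hq
  rw [shaAn_def, hlead, hreg, Complex.ofReal_one, mul_one] at hsha
  -- hsha : L * T² / (Ω * Tam) = q
  have hLval : Wd.entireLFunction 1 / (Wd.realPeriodRat : ℂ) = (qd : ℂ) := by
    have h1 : Wd.entireLFunction 1 * (Wd.torsionOrder : ℂ) ^ 2 =
        (q : ℂ) * ((Wd.realPeriodRat : ℂ) * (Wd.tamagawaProduct : ℂ)) := by
      rw [← hsha]; field_simp
    rw [hqd_def]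
    push_cast
    field_simp
    linear_combination h1
  refine ⟨qd, hLval, ?_, ?_⟩
  · -- `qd ≠ 0`
    intro hqd0
    apply hLd
    have := hLval
    rw [hqd0, Rat.cast_zero, div_eq_zero_iff] at this
    rcases this with h | h
    · exact h
    · exact absurd h hΩC
  · -- the valuation
    have hq0 : q ≠ 0 := by
      intro h0
      apply hLd
      have := hLval
      rw [hqd_def, h0, zero_mul, zero_div, Rat.cast_zero, div_eq_zero_iff] at this
      rcases this with h | h
      · exact h
      · exact absurd h hΩC
    have hTq : (Wd.torsionOrder : ℚ) ≠ 0 := by exact_mod_cast hT0.ne'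
    have hcq : (Wd.tamagawaProduct : ℚ) ≠ 0 := by exact_mod_cast hc0.ne'
    have hvT : padicValNat 2 Wd.torsionOrder = 0 :=
      padicValNat.eq_zero_of_not_dvd (fun h => (Nat.not_even_iff_odd.mpr hTodd) (even_iff_two_dvd.mpr h))
    rw [hqd_def, padicValRat.div (mul_ne_zero hq0 hcq) (pow_ne_zero _ hTq), padicValRat.mul hq0 hcq,
      padicValRat.pow, padicValRat.of_nat, padicValRat.of_nat, hv0, hvT, hvTam]
    push_cast
    ring

/-- The value stub from modularity, the `2`-converse, the route's four rank-`0` cruxes BY NAME and the Tamagawa receptacle. -/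
theorem doorTwistValueAtTwo_of_rankZero_cruxes (hmod : hasEntireLFunction_rat) (hConv : DoorTwistConverseAtTwo)
    (hR0 : GoodOrdinaryRankZeroAtTwo ∧ MultiplicativeRankZeroAtTwo ∧ SupersingularRankZeroAtTwo ∧ AdditiveRankZeroAtTwo)
    (hTam : DoorTwistTamagawaAtTwo) : DoorTwistValueAtTwo :=
  doorTwistValueAtTwo_of hmod hConv (doorTwistBSDTwoAtTwo_of_rankZero_cruxes hR0) hTam

end Summit.BirchSwinnertonDyer.BirchSwinnertonDyer.Theorems.RankOneAtTwoOneDoor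

end
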